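import Summits.CriticalPhenomena.PercolationContinuityZ3.Theorems.PercNearOneGluingNoHeavyLowerTailNineTypeLabelCert
import Summits.CriticalPhenomena.PercolationContinuityZ3.Theorems.PercNearOneGluingNoHeavyLowerTailNineTypeCellCount

/-!
# The row `Q44` for all `n`: reduction to a WEIGHTED antipodal count

Support file for crux `stmt-CriticalPhenomena-4575` (master-family programme; the quadratic four-point row `Q44` of `prim-bnk-1`
gen 13 — the last census-grade row in the FD44 oracle set; in the tree only for `n ≤ 5`, `q44_le_five`), seat `prim-bnk-1` gen 20;
memo `run/shared/lean/prim/prim-l12/FROM-prim-bnk-1-gen20-LABEL-ATLAS.md` §2–§4.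

In the cells of `FourPointAtoms.pat4` the row reads
`2·Q44 = 2[P(ab|cy)+P(abcy)]·P(∅) − 2·B1 − D`, with the weight-two part
`B1 = P(ab|cy)[P(ac|by)+P(ay|bc)] + P(ab|c|y)P(ay|bc) + P(a|b|cy)[P(ab|c|y)+P(ay|bc)]` (landed unweighted in
`…NineTypeLabelAtlas.pack_q44WeightTwo`) and the weight-one DART part
`D = P(a|by|c)[P(abc|y)+P(acy|b)] + P(a|b|cy)[P(abc|y)+P(aby|c)] + P(ac|b|y)[P(aby|c)+P(a|bcy)] + P(ab|c|y)[P(acy|b)+P(a|bcy)]`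
(the eight darts `x → x'` of the square `a–b–y–c–a`: the pair cell `{x,x'}` against the three-block on the other terminals).

* `TwoCopyMono.kerQ44 = kerP q44B1 + kerP q44Darts` — the integer kernel with `Σ_{i,j} κ i j · cᵢ cⱼ = 2·Q44` (`sum_kerQ44_cell`);
* `TwoCopyMono.goodKernel_kerQ44_iff_weightedCount` — **the fibre statement**: `kerQ44` is a `GoodKernel` iff for every monotone
  map `ι` from the subsets of a finite type to the 15 cells
  `#{T : (ι T, ι Tᶜ) ∈ B1 (either order)} + #{T : (ι T, ι Tᶜ) a dart (pair; block)} ≤ 2·#{T : ι T ∈ AC, ι Tᶜ = ⊥}`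
  (CONJECTURE W of the memo: verified on all 70 807 209 monotone maps of `B_4`, on every graph fibre with ≤ 6 edges on ≤ 5
  vertices and 2·10⁵ random fibres up to 13 edges; NOT a sum of two certifiable packings, see the memo);
* `TwoCopyMono.q44_cells_of_goodKernel` — **the reduction**: `GoodKernel kerQ44 → 2·Q44 ≥ 0` on every finite weighted graph, all `n`.

No sorries, no named facts, standard axioms; the hypothesis of the last theorem is the open combinatorial statement.
-/

namespace Summit.CriticalPhenomena.PercolationContinuityZ3.Theorems

namespace TwoCopyMono

open Finset FourPointAtoms

/-! ## The kernel -/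

/-- The five weight-two (heavy, light) pairs of `Q44`, both orientations:
`{ab|cy;ac|by}, {ab|cy;ay|bc}, {ab|c|y;ay|bc}, {ab|c|y;a|b|cy}, {a|b|cy;ay|bc}`. [this work] -/
def q44B1 : Finset (Fin 15 × Fin 15) :=
  {(11, 9), (9, 11), (11, 8), (8, 11), (6, 8), (8, 6), (6, 1), (1, 6), (1, 8), (8, 1)}

/-- The eight darts of `Q44`, oriented (pair cell; three-block):
`y→b (a|by|c; abc|y)`, `y→c (a|b|cy; abc|y)`, `c→a (ac|b|y; aby|c)`, `c→y (a|b|cy; aby|c)`, `b→a (ab|c|y; acy|b)`,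
`a→b (ab|c|y; a|bcy)`, `b→y (a|by|c; acy|b)`, `a→c (ac|b|y; a|bcy)`. [this work] -/
def q44Darts : Finset (Fin 15 × Fin 15) :=
  {(2, 13), (1, 13), (5, 12), (1, 12), (6, 10), (6, 7), (2, 10), (5, 7)}

/-- **The integer kernel of `2·Q44`**: `kerP q44B1 + kerP q44Darts`, i.e. `2·[i ∈ AC ∧ j = ⊥] − [(i,j) ∈ q44B1] − [(i,j) ∈ q44Darts]`
(the weight-two pairs enter in both orientations, the darts in the orientation (pair; block)). [this work] -/
def kerQ44 (i j : Fin 15) : ℤ := kerP q44B1 i j + kerP q44Darts i j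

/-! ## The fibre statement -/

/-- **`GoodKernel kerQ44` is the weighted count.**  `kerQ44` is good iff for every monotone cell map `ι` on the subsets of a
finite type, `#{T : (ι T, ι Tᶜ) ∈ q44B1} + #{T : (ι T, ι Tᶜ) ∈ q44Darts} ≤ 2 · #{T : ι T ∈ AC ∧ ι Tᶜ = ⊥}`. [this work] -/
theorem goodKernel_kerQ44_iff_weightedCount :
    GoodKernel kerQ44 ↔
      ∀ (γ : Type) [Fintype γ] [DecidableEq γ] (ι : Finset γ → Fin 15),
        (∀ A B : Finset γ, A ⊆ B → ple (ι A) (ι B) = true) →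
          #(Finset.univ.filter fun T => (ι T, ι Tᶜ) ∈ q44B1) + #(Finset.univ.filter fun T => (ι T, ι Tᶜ) ∈ q44Darts) ≤
            2 * #(Finset.univ.filter fun T => isAC (ι T) ∧ ι Tᶜ = 0) := by
  classical
  -- the antipodal sum of `pp ∘ ι` is `2·#𝔊 − #B1-points − #dart-points`
  have hsum : ∀ (γ : Type) [Fintype γ] [DecidableEq γ] (ι : Finset γ → Fin 15),
      (∑ T : Finset γ, liftK kerQ44 (pp (ι T)) (pp (ι Tᶜ))) =
        2 * (#(Finset.univ.filter fun T => isAC (ι T) ∧ ι Tᶜ = 0) : ℤ) -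
          (#(Finset.univ.filter fun T => (ι T, ι Tᶜ) ∈ q44B1) : ℤ) -
            (#(Finset.univ.filter fun T => (ι T, ι Tᶜ) ∈ q44Darts) : ℤ) := by
    intro γ _ _ ι
    have h1 : ∀ T : Finset γ, liftK kerQ44 (pp (ι T)) (pp (ι Tᶜ)) =
        ((if isAC (ι T) ∧ ι Tᶜ = 0 then (1 : ℤ) else 0) - (if (ι T, ι Tᶜ) ∈ q44B1 then (1 : ℤ) else 0)) +
          ((if isAC (ι T) ∧ ι Tᶜ = 0 then (1 : ℤ) else 0) - (if (ι T, ι Tᶜ) ∈ q44Darts then (1 : ℤ) else 0)) := by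
      intro T; rw [liftK_pp]; rfl
    simp_rw [h1]
    rw [Finset.sum_add_distrib, Finset.sum_sub_distrib, Finset.sum_sub_distrib, Finset.sum_boole, Finset.sum_boole,
      Finset.sum_boole]
    ring
  constructor
  · intro hK γ _ _ ι hmono
    have hmono' : ∀ A B : Finset γ, A ⊆ B → ProfLE (pp (ι A)) (pp (ι B)) :=
      fun A B hAB => profLE_of_ple (hmono A B hAB)
    have h0 : 0 ≤ ∑ T : Finset γ, liftK kerQ44 (pp (ι T)) (pp (ι Tᶜ)) :=
      hK.nonneg γ (fun T => pp (ι T)) hmono' (fun T => isEqv_pp (ι T))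
    rw [hsum γ ι] at h0
    have : (#(Finset.univ.filter fun T => (ι T, ι Tᶜ) ∈ q44B1) : ℤ) +
        (#(Finset.univ.filter fun T => (ι T, ι Tᶜ) ∈ q44Darts) : ℤ) ≤
          2 * (#(Finset.univ.filter fun T => isAC (ι T) ∧ ι Tᶜ = 0) : ℤ) := by linarith
    exact_mod_cast this
  · intro hcount
    refine ⟨fun γ _ _ P hmono heqv => ?_⟩
    have hex : ∀ T : Finset γ, ∃ i : Fin 15, P T = pp i := fun T => exists_pat_of_isEqv (heqv T)
    choose ι hι using hex
    have hle : ∀ A B : Finset γ, A ⊆ B → ple (ι A) (ι B) = true := by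
      intro A B hAB
      apply ple_of_profLE
      rw [← hι A, ← hι B]
      exact hmono A B hAB
    have hc := hcount γ ι hle
    have hP : (∑ T : Finset γ, liftK kerQ44 (P T) (P Tᶜ)) = ∑ T : Finset γ, liftK kerQ44 (pp (ι T)) (pp (ι Tᶜ)) := by
      refine Finset.sum_congr rfl fun T _ => ?_
      rw [hι T, hι Tᶜ]
    rw [hP, hsum γ ι]
    have : (#(Finset.univ.filter fun T => (ι T, ι Tᶜ) ∈ q44B1) : ℤ) +
        (#(Finset.univ.filter fun T => (ι T, ι Tᶜ) ∈ q44Darts) : ℤ) ≤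
          2 * (#(Finset.univ.filter fun T => isAC (ι T) ∧ ι Tᶜ = 0) : ℤ) := by exact_mod_cast hc
    linarith

/-! ## Law level -/

/-- Evaluation of the `Q44` kernel form on a cell vector: `Σ κᵢⱼ cᵢ cⱼ = 2(c₁₁+c₁₄)c₀ − 2·B1(c) − D(c)`. [this work] -/
theorem sum_kerQ44_cell (c : Fin 15 → ℝ) :
    (∑ i : Fin 15, ∑ j : Fin 15, (kerQ44 i j : ℝ) * c i * c j) =
      2 * ((c 11 + c 14) * c 0) -
        2 * (c 11 * c 9 + c 11 * c 8 + c 6 * c 8 + c 6 * c 1 + c 1 * c 8) -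
          (c 2 * c 13 + c 1 * c 13 + c 5 * c 12 + c 1 * c 12 + c 6 * c 10 + c 6 * c 7 + c 2 * c 10 + c 5 * c 7) := by
  have hsplit : ∀ i j : Fin 15, (kerQ44 i j : ℝ) * c i * c j =
      (kerP q44B1 i j : ℝ) * c i * c j + (kerP q44Darts i j : ℝ) * c i * c j := by
    intro i j; unfold kerQ44; push_cast; ring
  simp_rw [hsplit, Finset.sum_add_distrib]
  rw [sum_kerP_cell, sum_kerP_cell]
  have hB : (∑ p ∈ q44B1, c p.1 * c p.2) = 2 * (c 11 * c 9 + c 11 * c 8 + c 6 * c 8 + c 6 * c 1 + c 1 * c 8) := by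
    unfold q44B1
    rw [Finset.sum_insert (by decide), Finset.sum_insert (by decide), Finset.sum_insert (by decide), Finset.sum_insert (by decide),
      Finset.sum_insert (by decide), Finset.sum_insert (by decide), Finset.sum_insert (by decide), Finset.sum_insert (by decide),
      Finset.sum_insert (by decide), Finset.sum_singleton]
    ring
  have hD : (∑ p ∈ q44Darts, c p.1 * c p.2) =
      c 2 * c 13 + c 1 * c 13 + c 5 * c 12 + c 1 * c 12 + c 6 * c 10 + c 6 * c 7 + c 2 * c 10 + c 5 * c 7 := by
    unfold q44Darts
    rw [Finset.sum_insert (by decide), Finset.sum_insert (by decide), Finset.sum_insert (by decide), Finset.sum_insert (by decide),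
      Finset.sum_insert (by decide), Finset.sum_insert (by decide), Finset.sum_insert (by decide), Finset.sum_singleton]
    ring
  rw [hB, hD]; ring

/-- **`Q44` for all `n` from the weighted count (the reduction).**  If `kerQ44` is a good kernel (Conjecture W), then for every
finite weighted graph and all marked points,
`2·B1 + D ≤ 2[P(ab|cy)+P(abcy)]·P(a|b|c|y)`, i.e. `Q44 ≥ 0`. [this work] -/
theorem q44_cells_of_goodKernel (hK : GoodKernel kerQ44) {n : ℕ} (w : Sym2 (Fin n) → unitInterval) (a b c y : Fin n) :
    2 * (cell w a b c y 11 * cell w a b c y 9 + cell w a b c y 11 * cell w a b c y 8 + cell w a b c y 6 * cell w a b c y 8 +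
        cell w a b c y 6 * cell w a b c y 1 + cell w a b c y 1 * cell w a b c y 8) +
      (cell w a b c y 2 * cell w a b c y 13 + cell w a b c y 1 * cell w a b c y 13 + cell w a b c y 5 * cell w a b c y 12 +
        cell w a b c y 1 * cell w a b c y 12 + cell w a b c y 6 * cell w a b c y 10 + cell w a b c y 6 * cell w a b c y 7 +
        cell w a b c y 2 * cell w a b c y 10 + cell w a b c y 5 * cell w a b c y 7) ≤
      2 * ((cell w a b c y 11 + cell w a b c y 14) * cell w a b c y 0) := by
  have h := sum_kernel_cell_nonneg hK w a b c y
  rw [sum_kerQ44_cell] at h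
  linarith

/-- **What is proved unconditionally (all `n`): the weight-two part alone is packed**, `B1 ≤ [P(ab|cy)+P(abcy)]·P(∅)`, by the
label certificate of `…NineTypeLabelCert` (labels `5,5,5,8,6`, the last two with `a|b|cy` as heavy cell). [this work] -/
theorem q44_weightTwo_pack {n : ℕ} (w : Sym2 (Fin n) → unitInterval) (a b c y : Fin n) :
    cell w a b c y 11 * cell w a b c y 9 + cell w a b c y 11 * cell w a b c y 8 + cell w a b c y 6 * cell w a b c y 8 +
        cell w a b c y 1 * cell w a b c y 6 + cell w a b c y 1 * cell w a b c y 8 ≤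
      (cell w a b c y 11 + cell w a b c y 14) * cell w a b c y 0 := by
  have h := pack_of_tableOK ({(11, 9), (11, 8), (6, 8), (1, 6), (1, 8)} : Finset (Fin 15 × Fin 15))
    (fun p => if p = (11, 9) then 5 else if p = (11, 8) then 5 else if p = (6, 8) then 5 else if p = (1, 6) then 8 else 6)
    (by decide +kernel) w a b c y
  rw [Finset.sum_insert (by decide), Finset.sum_insert (by decide), Finset.sum_insert (by decide),
    Finset.sum_insert (by decide), Finset.sum_singleton] at h
  dsimp only at h
  linarith

end TwoCopyMono

end Summit.CriticalPhenomena.PercolationContinuityZ3.Theorems
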